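import Literature.NumberTheory.NumberFields.NFIsoNormPoly
import Literature.Computability.Complexity.NumberFieldIsomorphismProofs
import Literature.Computability.Complexity.IrreducibilityLLLPrimeSearch
import HarnessLib

/-!
# The norm polynomial is monic of exact degree, and the separability test (Landau 1985, §1)

Support file for the discharge of the named facts
`Literature.NumberTheory.NumberFields.nfIso_mem_P` /
`Literature.Computability.Complexity.lenstra_numberFieldIso_mem_P` (number-field isomorphism is in
`P`; A. K. Lenstra 1983 Thm. (3.7), Landau 1985; the two facts are equivalent,
`NumberFieldIsomorphismPEquiv.nfIso_mem_P_iff`). Two facts about the norm polynomial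
`N_c = Res_Y(q(Y), p(X − cY))` (`NFIsoResultant.normSym`, computed on lists by
`NFIsoNormPoly.normPoly`) that the decision procedure needs beyond `NFIsoNormPoly.normPoly_spec`:

* `map_normSym_eq_prod` — over `ℂ`, `N_c = ∏_{p(a)=0} ∏_{q(b)=0} (X − (a + c b))` (it agrees with the
  product at every integer by `Literature.Computability.Complexity.algebraMap_resultant_comp_eq_prod_pairSums`
  and `eval_normSym`); hence **`natDegree_normSym`**: `N_c` is MONIC of degree EXACTLY
  `deg p · deg q` (sharpening `natDegree_normSym_le`), and `monic_ofCoeffs_normPoly` — so the list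
  handed to the LLL small-factor test represents a monic polynomial of known degree;
* `sepTest f` — the squarefreeness test `Res(F, F') ≠ 0` through `resVal` (formal degrees `D`,
  `D - 1`), `resultant_derivative_ne_zero_iff` and **`sepTest_eq_true_iff`**: for a monic list,
  `sepTest f = true ↔ (ofCoeffs f)` is separable over `ℚ` — the hypothesis `hNsep` of
  `nfIsomorphic_iff_of_norm_values`, reached for some multiplier by
  `exists_multiplier_norm_separable`.

## References

* S. Landau, *Factoring polynomials over algebraic number fields*, SIAM J. Comput. 14 (1985)
  184–195, §1 (Thm. 1.4: the norm as a resultant; Thm. 1.5: squarefree norm for some `c`). [Landau1985]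
* H. Cohen, *A Course in Computational Algebraic Number Theory*, GTM 138, §3.3.2 (resultant and
  discriminant), §3.6.2, Alg. 3.6.4. [Cohen1993]
* A. K. Lenstra, EUROCAL '83 = MC report IW 213/82, Thm. (3.7). [Lenstra1983]
-/

noncomputable section

open Polynomial

namespace Literature.NumberTheory.NumberFields

open Literature.Computability.Complexity Literature.Computability.Complexity.SumcheckMA
  Literature.Computability.Complexity.LLLFactoring

/-! ### The norm polynomial over `ℂ`: exact degree and monicity -/

variable {p q : ℤ[X]}

/-- **Over `ℂ` the norm polynomial is `∏_{p(a)=0} ∏_{q(b)=0} (X − (a + c b))`** (it agrees with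
this product at every integer, by `algebraMap_resultant_comp_eq_prod_pairSums` and `eval_normSym`).
[cite: Landau1985, §1 (Thm. 1.4)] [cite: Cohen1993, §3.6.2] -/
theorem map_normSym_eq_prod (hp : p.Monic) (hq : q.Monic) (c : ℤ) :
    (normSym p q c).map (algebraMap ℤ ℂ) =
      (((p.aroots ℂ) ×ˢ (q.aroots ℂ)).map fun ij => X - C (ij.1 + (c : ℂ) * ij.2)).prod := by
  have hps : (p.map (algebraMap ℤ ℂ)).Splits := IsAlgClosed.splits _
  have hqs : (q.map (algebraMap ℤ ℂ)).Splits := IsAlgClosed.splits _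
  apply eq_of_infinite_eval_eq
  apply Set.Infinite.mono (s := Set.range (fun k : ℕ => (k : ℂ)))
  · rintro _ ⟨k, rfl⟩
    simp only [Set.mem_setOf_eq]
    rw [eval_map, eval₂_at_natCast, eval_normSym, algebraMap_resultant_comp_eq_prod_pairSums hp hq hps hqs c k,
      eval_multiset_prod, Multiset.map_map]
    refine congrArg _ (Multiset.map_congr rfl fun ij _ => ?_)
    simp
  · exact Set.infinite_range_of_injective Nat.cast_injective

/-- **The norm polynomial is monic of degree exactly `deg p · deg q`** (sharpening
`natDegree_normSym_le`). [cite: Landau1985, §1 (Thm. 1.4)] -/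
theorem natDegree_normSym (hp : p.Monic) (hq : q.Monic) (c : ℤ) :
    (normSym p q c).natDegree = p.natDegree * q.natDegree ∧ (normSym p q c).Monic := by
  have hinj : Function.Injective (algebraMap ℤ ℂ) := Int.cast_injective
  have hps : (p.map (algebraMap ℤ ℂ)).Splits := IsAlgClosed.splits _
  have hqs : (q.map (algebraMap ℤ ℂ)).Splits := IsAlgClosed.splits _
  have hmap := map_normSym_eq_prod hp hq c
  set s : Multiset ℂ := ((p.aroots ℂ) ×ˢ (q.aroots ℂ)).map fun ij => ij.1 + (c : ℂ) * ij.2 with hs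
  have hprod : (((p.aroots ℂ) ×ˢ (q.aroots ℂ)).map fun ij => X - C (ij.1 + (c : ℂ) * ij.2)).prod =
      (s.map fun z => X - C z).prod := by rw [hs, Multiset.map_map]; rfl
  have hcard : Multiset.card s = p.natDegree * q.natDegree := by
    rw [hs, Multiset.card_map, Multiset.card_product, aroots_def, aroots_def,
      ← hps.natDegree_eq_card_roots, ← hqs.natDegree_eq_card_roots, hp.natDegree_map, hq.natDegree_map]
  rw [hprod] at hmap
  constructor
  · rw [← natDegree_map_eq_of_injective hinj, hmap, natDegree_multiset_prod_X_sub_C_eq_card, hcard]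
  · refine monic_of_injective hinj ?_
    rw [hmap]
    exact monic_multiset_prod_of_monic _ _ fun z _ => monic_X_sub_C z

/-- **The computed norm list represents a monic polynomial of degree `n · m`.**
[cite: Landau1985, §1 (Thm. 1.4)] [cite: Cohen1993, Alg. 3.6.4 step 3] -/
theorem monic_ofCoeffs_normPoly {pl ql : List ℤ} {m n : ℕ} (hq : (ofCoeffs ql).Monic) (hp : (ofCoeffs pl).Monic)
    (hm : (ofCoeffs ql).natDegree = m) (hn : (ofCoeffs pl).natDegree = n) (c : ℤ) :
    (ofCoeffs (normPoly pl ql c m n)).Monic ∧ (ofCoeffs (normPoly pl ql c m n)).natDegree = n * m := by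
  rw [ofCoeffs_normPoly hm hn]
  obtain ⟨hdeg, hmon⟩ := natDegree_normSym hp hq c
  exact ⟨hmon, by rw [hdeg, hm, hn]⟩

/-! ### The separability test -/

/-- The squarefreeness test over `ℚ`: `Res(F, F') ≠ 0` (formal degrees `D`, `D - 1`).
[cite: Cohen1993, §3.3.2 (discriminant and resultant)] [cite: Landau1985, §1 (Thm. 1.5: squarefree norm)] -/
def sepTest (f : List ℤ) : Bool := !decide (resVal f (pderiv f) (f.length - 1) (f.length - 2) = 0)

/-- **`R(F, F') ≠ 0` iff `F` is separable over `ℚ`**, for `F ∈ ℤ[X]` monic. [cite: Cohen1993, §3.3.2] -/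
theorem resultant_derivative_ne_zero_iff {F : ℤ[X]} (hF : F.Monic) :
    resultant F (derivative F) ≠ 0 ↔ (F.map (Int.castRingHom ℚ)).Separable := by
  set ψ := Int.castRingHom ℚ with hψ
  have hψi : Function.Injective ψ := Int.cast_injective
  have hFm : (F.map ψ).Monic := hF.map ψ
  have hres : resultant (F.map ψ) (derivative (F.map ψ)) = ψ (resultant F (derivative F)) := by
    rw [derivative_map, resultant, natDegree_map_eq_of_injective hψi, natDegree_map_eq_of_injective hψi,
      ← resultant_map_map]
    rfl
  rw [separable_def, ← isUnit_resultant_iff_isCoprime hFm, hres, isUnit_iff_ne_zero, hψ, map_ne_zero_iff _ hψi]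

/-- `R(F, F') ≠ 0` for `F` monic separable over `ℚ` (the form used by the prime search). [folklore] -/
theorem resultant_derivative_ne_zero_of_separable {F : ℤ[X]} (hF : F.Monic)
    (hsep : (F.map (Int.castRingHom ℚ)).Separable) : resultant F (derivative F) ≠ 0 :=
  (resultant_derivative_ne_zero_iff hF).2 hsep

/-- **Correctness of the separability test**: for `f` a monic list of degree `D`,
`sepTest f = true` iff `ofCoeffs f` is separable over `ℚ`. [cite: Cohen1993, §3.3.2] [cite: Landau1985, §1 (Thm. 1.5)] -/
theorem sepTest_eq_true_iff {f : List ℤ} {D : ℕ} (hf : MonicList f D) :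
    sepTest f = true ↔ ((ofCoeffs f).map (Int.castRingHom ℚ)).Separable := by
  obtain ⟨hmon, hdeg⟩ := hf.monic_ofCoeffs
  have hl1 : f.length - 1 = D := by rw [hf.1]; rfl
  have hl2 : f.length - 2 = D - 1 := by rw [hf.1]; omega
  have hder : (derivative (ofCoeffs f)).natDegree = D - 1 := by rw [natDegree_derivative, hdeg]
  have hres : resVal f (pderiv f) (f.length - 1) (f.length - 2) = resultant (ofCoeffs f) (derivative (ofCoeffs f)) := by
    rw [resVal_eq, ofCoeffs_pderiv, hl1, hl2, resultant, resultant, hdeg, hder]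
  rw [sepTest, hres, ← resultant_derivative_ne_zero_iff hmon]
  simp

end Literature.NumberTheory.NumberFields
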